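import Literature.MathematicalPhysics.QuantumFieldTheory.Balaban1983to89.B9QstarLettersAtPins

/-!
# `Balaban1983to89.B9QstarLettersAtPinsL2` — THE KINEMATIC LETTER `Q*(U)` AT THE PINS, BLOCK-L² TWIN: node00-def-Y's `QscoKH` satisfies
# `‖1_{Δ(y)}Q*(U)μ‖₂ ≤ √(n_{y′}⁻¹)·e^{δ(ℓ+4)}·e^{−δd(y,y′)}·‖1_{Δ(y′)}μ‖₂` at every contracting configuration, uniformly on the k-level census

T. Bałaban, *Propagators for lattice gauge theories in a background field*, Commun. Math. Phys. **99** (1985) 389–434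
[`Balaban1985BackgroundPropagators`, "B9"]; [4] = T. Bałaban, *Propagators and renormalization transformations for lattice gauge
theories. II*, Commun. Math. Phys. **96** (1984) 223–250 [`Balaban1984PropagatorsII`]; [3] = part I, Commun. Math. Phys. **95** (1984) 17–40
[`Balaban1984PropagatorsI`].

statement-level skeleton of published theorems with citation tags; proofs where landed; nothing here is a claim about the Yang–Mills
mass gap

THE PRINTED LOCI.  [B9] (3.12)–(3.14) p. 393 (`Q(U)`, `Q*` its adjoint), (3.110) p. 417 (normalisation of the weights), (3.46) p. 398 (the block-L²
classes), p. 398 (remark after (3.47): the powers of `Lʲη` may be split between the two blocks), Thm 3.13 p. 426 (the `Q*`-composites of the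
reduction); [3] (1.18) p. 20 (`0 ≤ q_y(f) ≤ L^{−j(d+1)}`, `Σ_f q_y(f) = 1`); [4] Lemma 2.1 (2.60) p. 234 (scale transfer).

THE POINT (sequel of `B9QstarLettersAtPins`, same seat, same coordination: dag-lead DEDUP-381 ∕ dag-n06-l COORD-1).  The sup letter of `Q*(U)` is
the predecessor; THIS FILE is the block-L² twin dag-n06-l's L² fields (`Letters313L2PZ.gQs ∕ dGQs ∕ ddGQs ∕ dGQsd`) compose with:
* §1 private block-square bookkeeping (`bsq_le_bsq_of_abs_le`, `bsq_le_sum_of_sq_le`, `bsq_eq_zero_of_apply_eq_zero`, the product factorisation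
  `bsq_prod_factor`, the slice sum `sum_sq_slices_le_bsq`);
* §2 ★★ `blockBd_QscoKH` — `BlockBd blkHK (blkBK bI) (Q*(U₁)) (√(n_{y′}⁻¹)·e^{δ(ℓ+4)}·e^{−δd})`, every `δ ≥ 0`: pointwise the predecessor's
  `abs_QscoKH_apply_le`, then Cauchy–Schwarz in the `|κ|` real coordinates of each slice, `Σ_{f∈Δ(y)} q_{y′}(f)² ≤ n_{y′}⁻¹·Σ_f q_{y′}(f) = n_{y′}⁻¹`
  and the collapse `(cR39 b)⁻¹·coordBound·basisBound·|κ| ≤ 1`; ★ `blockBd_QscoKH_len` — the length-ratio form `L·e^{(δ+ε)(ℓ+4)}·(Lʲη)⁻¹·(√(n⁻¹)·L^{j′}η)(y′)·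
  e^{−δd}` above the (2.60) threshold `log L ≤ ε(2L² − 1)M` (dag-n06-w3 `len_pow_le_of_transfer`);
* §3 at def-Y's members: `blockBd_Qstar_pins ∕ blockBd_Qstar_pins_len` at `QscoKH x.toKIdx (trBasis N) (bg9Y …) (fun U => U) (parBY x.toKIdx) U`,
  every member, every (3.35)-regular `U` (`parBY_norm_le_one_of_reg335`).

HONEST SCOPE.  Finite-dimensional lattice bookkeeping for ONE kinematic letter; no propagator estimate of [B9] is asserted; inputs cited by name
(r03 `qwt_le ∕ sum_qwt_eq_one`, dag-n06-w3 `dist_le_of_qwt_ne_zero_bI ∕ len_pow_le_of_transfer`, n06-d's coordinate dictionary).  A helper for the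
N06 certificate; COUNT-NEUTRAL; N06 is NOT discharged; one finite lattice at a time; nothing continuum, nothing about the mass gap ∕ Clay.  Cell
`pub-ymgap` (HUMAN RULING D-0062 ∕ D-0154), Track A node N06 [B9], width seat `pub-ymgap-dag-n06-w5` (g0), 2026-08-28.
-/

noncomputable section

namespace Literature.MathematicalPhysics.QuantumFieldTheory.Balaban1983to89.B9QstarLettersAtPinsL2

open B6Geom246MultiLevelTorus (geomT)
open B6GlobalChartV1 (PV blkV1)
open B6KLevelCensusIndexV1 (KIdx)
open B6Ineq2142KLevelV1 (lvl β qwt qwt_nonneg qwt_le)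
open B9Eq3132Ineq2142Covariant (sum_qwt_eq_one)
open B9GeoNormsKLevelV1 (geo9K geo9K_dist_nonneg)
open B9GeoLemma21KLevelV1 (geo9K_dist_comm geo9K_len_pos)
open B9Thm39ReadingCoords (cR39 cR39_nonneg coordBound39 basisBound39)
open B9Thm34Ext (toB6)
open B9SectDL2Decay (bsq bl2 bl2_nonneg bsq_nonneg BlockBd)
open B9CoReadingCoords (XBK blkBK)
open B9CoReadingCoordsH (XHK blkHK)
open B9Letters313AtOneQ (dist_le_of_qwt_ne_zero_bI len_pow_le_of_transfer)
open B9QstarLettersAtPins (abs_QscoKH_apply_le reading_const_collapse parBY_norm_le_one_of_reg335)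
open Node00 Node00.OpsYSectDCoords
open scoped Matrix

variable {d ℓ : ℕ} {hd : 1 ≤ d + 1} {hL : Odd (ℓ + 1) ∧ 1 < ℓ + 1} {b₀ b₁ : ℝ}

/-! ## §1–§2 The block-L² letter: `‖1_{Δ(y)}Q*(U₁)μ‖₂ ≤ √(n_{y′}⁻¹)·e^{δ(ℓ+4)}·e^{−δd}·‖1_{Δ(y′)}μ‖₂` -/

section L2

variable {𝔸 : Type} [NormedRing 𝔸] [NormedAlgebra ℂ 𝔸] [CompleteSpace 𝔸] [FiniteDimensional ℝ 𝔸]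
variable {κ : Type} [Fintype κ]
variable (i : KIdx d ℓ hd hL b₀ b₁) (b : Module.Basis κ ℝ 𝔸) (B : B9.Backgrounds) (cfg : B.Cfg → CfgY 𝔸 i) (parB : BondParY 𝔸 i)
variable {bI : FBondY i → IBondY i}

omit [Fintype κ] in
/-- Block squares are monotone under pointwise domination of absolute values. [folklore] -/
private theorem bsq_le_bsq_of_abs_le {G : B6.Geometry} {X : Type} [Fintype X] (blk : X → G.Site) (y : G.Site) {f g : X → ℝ}
    (h : ∀ x, |f x| ≤ g x) : bsq blk y f ≤ bsq blk y g := by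
  classical
  unfold bsq
  refine Finset.sum_le_sum fun x _ => ?_
  split_ifs
  · calc f x ^ 2 = |f x| ^ 2 := (sq_abs _).symm
      _ ≤ g x ^ 2 := pow_le_pow_left₀ (abs_nonneg _) (h x) 2
  · exact le_rfl

omit [Fintype κ] in
/-- A block square is bounded by any sum dominating its squares termwise on the block. [folklore] -/
private theorem bsq_le_sum_of_sq_le {G : B6.Geometry} {X : Type} [Fintype X] (blk : X → G.Site) (y : G.Site) {f g : X → ℝ}
    (hg : ∀ x, 0 ≤ g x) (h : ∀ x, blk x = y → f x ^ 2 ≤ g x) : bsq blk y f ≤ ∑ x, g x := by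
  classical
  unfold bsq
  refine Finset.sum_le_sum fun x _ => ?_
  split_ifs with hx
  · exact h x hx
  · exact hg x

omit [Fintype κ] in
/-- A function vanishing on the block has block square zero. [folklore] -/
private theorem bsq_eq_zero_of_apply_eq_zero {G : B6.Geometry} {X : Type} [Fintype X] (blk : X → G.Site) (y : G.Site) {f : X → ℝ}
    (h : ∀ x, blk x = y → f x = 0) : bsq blk y f = 0 := by
  classical
  unfold bsq
  refine Finset.sum_eq_zero fun x _ => ?_
  split_ifs with hx
  · rw [h x hx]; ring
  · rfl

omit [Fintype κ] in
/-- A product-form block square over a product carrier `S × T` blocked through the first factor factorises: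
`bsq (blk ∘ fst) y (A ⊗ G) = bsq blk y A · Σ_t G(t)²`. [folklore] -/
private theorem bsq_prod_factor {G6 : B6.Geometry} {S T : Type} [Fintype S] [Fintype T] (blk : S → G6.Site) (y : G6.Site)
    (A : S → ℝ) (Gf : T → ℝ) :
    bsq (fun p : S × T => blk p.1) y (fun p => A p.1 * Gf p.2) = bsq blk y A * ∑ t, Gf t ^ 2 := by
  classical
  unfold bsq
  rw [Fintype.sum_prod_type, Finset.sum_mul]
  refine Finset.sum_congr rfl fun s _ => ?_
  split_ifs
  · rw [Finset.mul_sum]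
    exact Finset.sum_congr rfl fun t _ => by ring
  · simp

/-- The squares of the localised input over the `(ν, a, c′)`-slices add up to its block square at `y′`:
`Σ_ν Σ_{c′} Σ_a μ(y′, ν, a, c′)² ≤ bsq blkHK y′ μ` (in fact equal). [folklore] -/
private theorem sum_sq_slices_le_bsq (μ : XHK κ i → ℝ) (y' : IBondY i) {G : B6.Geometry} (e : IBondY i → G.Site) (he : Function.Injective e) :
    ∑ ν : Fin (d + 1), ∑ c' : κ, ∑ a : κ, μ (y', ν, a, c') ^ 2 ≤ bsq (fun q : XHK κ i => e q.1) (e y') μ := by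
  classical
  have hre : bsq (fun q : XHK κ i => e q.1) (e y') μ = ∑ q : XHK κ i, if q.1 = y' then μ q ^ 2 else 0 := by
    unfold bsq
    refine Finset.sum_congr rfl fun q _ => ?_
    simp only [he.eq_iff]
  rw [hre, Fintype.sum_prod_type, Finset.sum_eq_single y']
  · simp only [if_true]
    rw [Fintype.sum_prod_type]
    refine Finset.sum_le_sum fun ν _ => ?_
    rw [Fintype.sum_prod_type, Finset.sum_comm]
  · intro y _ hy; simp [hy]
  · intro h; exact absurd (Finset.mem_univ y') h

/-- ★★ **THE BLOCK-L² LETTER OF `Q*(U₁)` AT THE PINS**: for `bI` 1-faithful and contracting transporters,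
`‖1_{Δ(y)}Q*(U₁)μ‖₂ ≤ √(n_{y′}⁻¹)·e^{δ(ℓ+4)}·e^{−δd(y,y′)}·‖1_{Δ(y′)}μ‖₂` (`supp μ ⊂ Δ(y′)`), every `δ ≥ 0` — Cauchy–Schwarz in the `|κ|` real coordinates
of each slice, `Σ_{f∈Δ(y)} q_{y′}(f)² ≤ n_{y′}⁻¹·Σ_f q_{y′}(f) = n_{y′}⁻¹` ([3] (1.18)), the reading constant collapsing as in §2.
[cite: Balaban1985BackgroundPropagators, (3.12)–(3.14) p.393, (3.110) p.417, (3.46) p.398, Thm 3.13 p.426 (the letter Q*); Balaban1984PropagatorsI, (1.18) p.20] -/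
theorem blockBd_QscoKH
    (hβ1 : ∀ f : FBondY i, (geomT i.D).dist (β i.hN i.D i.hk (bI f)) (blkV1 i.hN i.D f) ≤ 1) {U₁ : B.Cfg}
    (hpar : ∀ s s', ‖(parB (cfg U₁) s s' : 𝔸)‖ ≤ 1 ∧ ‖(((parB (cfg U₁) s s')⁻¹ : 𝔸ˣ) : 𝔸)‖ ≤ 1)
    {δ : ℝ} (hδ : 0 ≤ δ) (R₀ : ℝ) (H₀ : Prop) [Fintype (geo9K i).Site] :
    BlockBd (g := toB6 (geo9K i) R₀ H₀) (blkHK i) (blkBK i bI) (QscoKH i b B cfg parB U₁)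
      (fun y y' => Real.sqrt (((((ℓ + 1 : ℕ) : ℝ) ^ (d + 1)) ^ lvl i.hN i.D i.hk y')⁻¹) *
        (Real.exp (δ * ((ℓ : ℝ) + 4)) * Real.exp (-(δ * (geo9K i).dist y y')))) := by
  classical
  intro y' μ hoff y
  change IBondY i at y' y
  have hoff' : ∀ q : XHK κ i, q.1 ≠ y' → μ q = 0 := fun q hq => hoff q hq
  -- letters
  set pl : ℝ := ((((ℓ + 1 : ℕ) : ℝ) ^ (d + 1)) ^ lvl i.hN i.D i.hk y')⁻¹ with hpl
  set C₀ : ℝ := (cR39 b)⁻¹ * (coordBound39 b * basisBound39 b) with hC₀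
  set S : Fin (d + 1) × κ × κ → ℝ := fun t => ∑ a, |μ (y', t.1, a, t.2.2)| with hS
  set F : XBK κ i → ℝ := fun p => qwt i.hN i.D i.hk y' p.1 * (C₀ * S p.2) with hF
  have hpl0 : 0 ≤ pl := by positivity
  have hC₀0 : 0 ≤ C₀ := mul_nonneg (inv_nonneg.mpr (cR39_nonneg b))
    (mul_nonneg (norm_nonneg _) (Finset.sum_nonneg fun _ _ => norm_nonneg _))
  have hE0 : 0 ≤ Real.exp (δ * ((ℓ : ℝ) + 4)) * Real.exp (-(δ * (geo9K i).dist y y')) := by positivity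
  -- pointwise: |Q*μ| ≤ F
  have hpt : ∀ p : XBK κ i, |QscoKH i b B cfg parB U₁ μ p| ≤ F p := fun p => by
    have := abs_QscoKH_apply_le i b B cfg parB U₁ hpar hoff' p
    simp only [hF, hC₀, hS]
    calc |QscoKH i b B cfg parB U₁ μ p| ≤ _ := this
      _ = _ := by ring
  -- the square sum factorises
  have hbsq : bsq (g := toB6 (geo9K i) R₀ H₀) (blkBK i bI) y (QscoKH i b B cfg parB U₁ μ) ≤
      bsq (g := toB6 (geo9K i) R₀ H₀) bI y (fun f => qwt i.hN i.D i.hk y' f) * ∑ t : Fin (d + 1) × κ × κ, (C₀ * S t) ^ 2 := by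
    refine (bsq_le_bsq_of_abs_le (G := toB6 (geo9K i) R₀ H₀) (blkBK i bI) y hpt).trans (le_of_eq ?_)
    exact bsq_prod_factor (G6 := toB6 (geo9K i) R₀ H₀) bI y (fun f => qwt i.hN i.D i.hk y' f) (fun t => C₀ * S t)
  -- first factor: Σ_{f ∈ Δ(y)} q² ≤ n⁻¹, and = 0 off the radius ℓ + 4
  have hq2 : bsq (g := toB6 (geo9K i) R₀ H₀) bI y (fun f => qwt i.hN i.D i.hk y' f) ≤ pl := by
    refine (bsq_le_sum_of_sq_le (G := toB6 (geo9K i) R₀ H₀) bI y (g := fun f => pl * qwt i.hN i.D i.hk y' f)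
      (fun f => mul_nonneg hpl0 (qwt_nonneg _ _ _ _ _)) fun f _ => ?_).trans (le_of_eq ?_)
    · show qwt i.hN i.D i.hk y' f ^ 2 ≤ pl * qwt i.hN i.D i.hk y' f
      rw [sq]; exact mul_le_mul_of_nonneg_right (qwt_le _ _ _ _ _) (qwt_nonneg _ _ _ _ _)
    · rw [← Finset.mul_sum, sum_qwt_eq_one i y', mul_one]
  have hq2far : ¬ (geo9K i).dist y y' ≤ (ℓ : ℝ) + 4 → bsq (g := toB6 (geo9K i) R₀ H₀) bI y (fun f => qwt i.hN i.D i.hk y' f) = 0 :=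
    fun hfar => bsq_eq_zero_of_apply_eq_zero (G := toB6 (geo9K i) R₀ H₀) bI y fun f hf => by
      show qwt i.hN i.D i.hk y' f = 0
      by_contra hq
      exact hfar (by rw [← hf, geo9K_dist_comm]; exact dist_le_of_qwt_ne_zero_bI i hβ1 hq)
  have hq2' : bsq (g := toB6 (geo9K i) R₀ H₀) bI y (fun f => qwt i.hN i.D i.hk y' f) ≤
      pl * (Real.exp (δ * ((ℓ : ℝ) + 4)) * Real.exp (-(δ * (geo9K i).dist y y'))) ^ 2 := by
    by_cases hnear : (geo9K i).dist y y' ≤ (ℓ : ℝ) + 4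
    · have hK1 : 1 ≤ Real.exp (δ * ((ℓ : ℝ) + 4)) * Real.exp (-(δ * (geo9K i).dist y y')) := by
        rw [← Real.exp_add]
        exact Real.one_le_exp (by nlinarith [mul_le_mul_of_nonneg_left hnear hδ])
      calc _ ≤ pl := hq2
        _ = pl * 1 ^ 2 := by ring
        _ ≤ _ := mul_le_mul_of_nonneg_left (pow_le_pow_left₀ zero_le_one hK1 2) hpl0
    · rw [hq2far hnear]; positivity
  -- second factor: Cauchy–Schwarz in the coordinate `a`, then the slices add up to the block square
  have hS2 : ∑ t : Fin (d + 1) × κ × κ, (C₀ * S t) ^ 2 ≤ (C₀ * (Fintype.card κ : ℝ)) ^ 2 * bsq (g := toB6 (geo9K i) R₀ H₀) (blkHK i) y' μ := by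
    have hcs : ∀ t : Fin (d + 1) × κ × κ, S t ^ 2 ≤ (Fintype.card κ : ℝ) * ∑ a, μ (y', t.1, a, t.2.2) ^ 2 := fun t => by
      have h := sq_sum_le_card_mul_sum_sq (s := (Finset.univ : Finset κ)) (f := fun a => |μ (y', t.1, a, t.2.2)|)
      simp only [Finset.card_univ, sq_abs] at h
      exact h
    calc ∑ t : Fin (d + 1) × κ × κ, (C₀ * S t) ^ 2 = ∑ t : Fin (d + 1) × κ × κ, C₀ ^ 2 * S t ^ 2 :=
          Finset.sum_congr rfl fun t _ => by ring
      _ ≤ ∑ t : Fin (d + 1) × κ × κ, C₀ ^ 2 * ((Fintype.card κ : ℝ) * ∑ a, μ (y', t.1, a, t.2.2) ^ 2) :=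
          Finset.sum_le_sum fun t _ => mul_le_mul_of_nonneg_left (hcs t) (sq_nonneg _)
      _ = C₀ ^ 2 * (Fintype.card κ : ℝ) * ∑ t : Fin (d + 1) × κ × κ, ∑ a, μ (y', t.1, a, t.2.2) ^ 2 := by
          rw [Finset.mul_sum]; exact Finset.sum_congr rfl fun t _ => by ring
      _ = C₀ ^ 2 * (Fintype.card κ : ℝ) * ((Fintype.card κ : ℝ) * ∑ ν : Fin (d + 1), ∑ c' : κ, ∑ a : κ, μ (y', ν, a, c') ^ 2) := by
          congr 1
          rw [Fintype.sum_prod_type, Finset.mul_sum]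
          refine Finset.sum_congr rfl fun ν _ => ?_
          simp only [Fintype.sum_prod_type, Finset.sum_const, Finset.card_univ, nsmul_eq_mul]
      _ ≤ C₀ ^ 2 * (Fintype.card κ : ℝ) * ((Fintype.card κ : ℝ) * bsq (g := toB6 (geo9K i) R₀ H₀) (blkHK i) y' μ) :=
          mul_le_mul_of_nonneg_left (mul_le_mul_of_nonneg_left
            (sum_sq_slices_le_bsq i μ y' (G := toB6 (geo9K i) R₀ H₀) (fun a : IBondY i => a) (fun _ _ h => h)) (Nat.cast_nonneg _))
            (mul_nonneg (sq_nonneg _) (Nat.cast_nonneg _))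
      _ = (C₀ * (Fintype.card κ : ℝ)) ^ 2 * bsq (g := toB6 (geo9K i) R₀ H₀) (blkHK i) y' μ := by ring
  -- the reading constant collapses: C₀·|κ| = (cR39 b)⁻¹·cR39 b ≤ 1
  have hCκ : C₀ * (Fintype.card κ : ℝ) ≤ 1 := by
    have h1 := reading_const_collapse b (κ := κ) (Bμ := 1) zero_le_one
    simp only [hC₀]
    calc (cR39 b)⁻¹ * (coordBound39 b * basisBound39 b) * (Fintype.card κ : ℝ)
        = (cR39 b)⁻¹ * (coordBound39 b * (basisBound39 b * ((Fintype.card κ : ℝ) * 1))) := by ring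
      _ ≤ 1 := h1
  have hCκ0 : 0 ≤ C₀ * (Fintype.card κ : ℝ) := mul_nonneg hC₀0 (Nat.cast_nonneg _)
  -- assemble
  have hsq : bsq (g := toB6 (geo9K i) R₀ H₀) (blkBK i bI) y (QscoKH i b B cfg parB U₁ μ) ≤
      (Real.sqrt pl * (Real.exp (δ * ((ℓ : ℝ) + 4)) * Real.exp (-(δ * (geo9K i).dist y y'))) * bl2 (g := toB6 (geo9K i) R₀ H₀) (blkHK i) y' μ) ^ 2 := by
    have hb0 : 0 ≤ bsq (g := toB6 (geo9K i) R₀ H₀) (blkHK i) y' μ := bsq_nonneg _ _ _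
    calc bsq (g := toB6 (geo9K i) R₀ H₀) (blkBK i bI) y (QscoKH i b B cfg parB U₁ μ)
        ≤ bsq (g := toB6 (geo9K i) R₀ H₀) bI y (fun f => qwt i.hN i.D i.hk y' f) * ∑ t : Fin (d + 1) × κ × κ, (C₀ * S t) ^ 2 := hbsq
      _ ≤ (pl * (Real.exp (δ * ((ℓ : ℝ) + 4)) * Real.exp (-(δ * (geo9K i).dist y y'))) ^ 2) *
            ((C₀ * (Fintype.card κ : ℝ)) ^ 2 * bsq (g := toB6 (geo9K i) R₀ H₀) (blkHK i) y' μ) :=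
          mul_le_mul hq2' hS2 (Finset.sum_nonneg fun _ _ => sq_nonneg _) (by positivity)
      _ ≤ (pl * (Real.exp (δ * ((ℓ : ℝ) + 4)) * Real.exp (-(δ * (geo9K i).dist y y'))) ^ 2) * (1 ^ 2 * bsq (g := toB6 (geo9K i) R₀ H₀) (blkHK i) y' μ) :=
          mul_le_mul_of_nonneg_left (mul_le_mul_of_nonneg_right (pow_le_pow_left₀ hCκ0 hCκ 2) hb0) (by positivity)
      _ = (Real.sqrt pl * (Real.exp (δ * ((ℓ : ℝ) + 4)) * Real.exp (-(δ * (geo9K i).dist y y'))) * bl2 (g := toB6 (geo9K i) R₀ H₀) (blkHK i) y' μ) ^ 2 := by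
          simp only [mul_pow, Real.sq_sqrt hpl0, B9SectDL2Decay.bl2_sq]; ring
  have hR0 : 0 ≤ Real.sqrt pl * (Real.exp (δ * ((ℓ : ℝ) + 4)) * Real.exp (-(δ * (geo9K i).dist y y'))) * bl2 (g := toB6 (geo9K i) R₀ H₀) (blkHK i) y' μ :=
    mul_nonneg (mul_nonneg (Real.sqrt_nonneg _) hE0) (bl2_nonneg _ _ _)
  calc bl2 (g := toB6 (geo9K i) R₀ H₀) (blkBK i bI) y (QscoKH i b B cfg parB U₁ μ) = Real.sqrt (bsq (g := toB6 (geo9K i) R₀ H₀) (blkBK i bI) y (QscoKH i b B cfg parB U₁ μ)) := rfl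
    _ ≤ Real.sqrt ((Real.sqrt pl * (Real.exp (δ * ((ℓ : ℝ) + 4)) * Real.exp (-(δ * (geo9K i).dist y y'))) * bl2 (g := toB6 (geo9K i) R₀ H₀) (blkHK i) y' μ) ^ 2) :=
        Real.sqrt_le_sqrt hsq
    _ = _ := Real.sqrt_sq hR0

/-- ★ **THE BLOCK-L² LETTER, LENGTH-RATIO FORM** (the shape dag-n06-l's L² fields compose with: one power of `L^{j′}η` for the source block against one
inverse power of `Lʲη` for the target): above the [4] (2.60) transfer threshold `log L ≤ ε(2L² − 1)M`,
`‖1_{Δ(y)}Q*μ‖₂ ≤ L·e^{(δ+ε)(ℓ+4)}·(Lʲη)⁻¹·(√(n_{y′}⁻¹)·L^{j′}η)·e^{−δd(y,y′)}·‖1_{Δ(y′)}μ‖₂` — `Lʲη ≤ L·e^{εd}·L^{j′}η` costs the rate `ε` on the support radius.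
[cite: Balaban1985BackgroundPropagators, (3.46) p.398 + p.398 (remark after (3.47)), Thm 3.13 p.426; Balaban1984PropagatorsII, Lemma 2.1 (2.60) p.234] -/
theorem blockBd_QscoKH_len
    (hβ1 : ∀ f : FBondY i, (geomT i.D).dist (β i.hN i.D i.hk (bI f)) (blkV1 i.hN i.D f) ≤ 1) {U₁ : B.Cfg}
    (hpar : ∀ s s', ‖(parB (cfg U₁) s s' : 𝔸)‖ ≤ 1 ∧ ‖(((parB (cfg U₁) s s')⁻¹ : 𝔸ˣ) : 𝔸)‖ ≤ 1)
    {δ ε : ℝ} (hδ : 0 ≤ δ) (hε : 0 < ε)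
    (hM : Real.log (geo9K i).L ≤ ε * (2 * ((ℓ : ℝ) + 1) ^ 2 - 1) * (geo9K i).M)
    (R₀ : ℝ) (H₀ : Prop) [Fintype (geo9K i).Site] :
    BlockBd (g := toB6 (geo9K i) R₀ H₀) (blkHK i) (blkBK i bI) (QscoKH i b B cfg parB U₁)
      (fun y y' => (geo9K i).L * Real.exp ((δ + ε) * ((ℓ : ℝ) + 4)) * ((geo9K i).len y)⁻¹ *
        (Real.sqrt (((((ℓ + 1 : ℕ) : ℝ) ^ (d + 1)) ^ lvl i.hN i.D i.hk y')⁻¹) * (geo9K i).len y') *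
          Real.exp (-(δ * (geo9K i).dist y y'))) := by
  have hδε : 0 ≤ δ + ε := by linarith
  refine (blockBd_QscoKH i b B cfg parB hβ1 hpar hδε R₀ H₀).mono fun y y' => ?_
  change IBondY i at y y'
  have hly : 0 < (geo9K i).len y := geo9K_len_pos i y
  -- (2.60): Lʲη ≤ L·e^{εd(y′,y)}·L^{j′}η, i.e. 1 ≤ L·e^{εd}·(Lʲη)⁻¹·L^{j′}η
  have hM1 : ((1 : ℕ) : ℝ) * Real.log (geo9K i).L ≤ ε * (2 * ((ℓ : ℝ) + 1) ^ 2 - 1) * (geo9K i).M := by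
    rw [Nat.cast_one, one_mul]; exact hM
  have ht := len_pow_le_of_transfer i hε 1 hM1 y' y
  rw [pow_one, pow_one, pow_one, geo9K_dist_comm] at ht
  have h1 : (1 : ℝ) ≤ (geo9K i).L * Real.exp (ε * (geo9K i).dist y y') * (((geo9K i).len y)⁻¹ * (geo9K i).len y') := by
    rw [show (geo9K i).L * Real.exp (ε * (geo9K i).dist y y') * (((geo9K i).len y)⁻¹ * (geo9K i).len y') =
      ((geo9K i).len y)⁻¹ * ((geo9K i).L * Real.exp (ε * (geo9K i).dist y y') * (geo9K i).len y') by ring]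
    rw [le_inv_mul_iff₀ hly, mul_one]
    exact ht
  -- e^{−(δ+ε)d}·e^{εd} = e^{−δd}: the transfer's rate ε is absorbed
  have hE : Real.exp (-((δ + ε) * (geo9K i).dist y y')) * Real.exp (ε * (geo9K i).dist y y') =
      Real.exp (-(δ * (geo9K i).dist y y')) := by rw [← Real.exp_add]; congr 1; ring
  calc Real.sqrt (((((ℓ + 1 : ℕ) : ℝ) ^ (d + 1)) ^ lvl i.hN i.D i.hk y')⁻¹) *
        (Real.exp ((δ + ε) * ((ℓ : ℝ) + 4)) * Real.exp (-((δ + ε) * (geo9K i).dist y y')))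
      = Real.sqrt (((((ℓ + 1 : ℕ) : ℝ) ^ (d + 1)) ^ lvl i.hN i.D i.hk y')⁻¹) *
        (Real.exp ((δ + ε) * ((ℓ : ℝ) + 4)) * Real.exp (-((δ + ε) * (geo9K i).dist y y'))) * 1 := (mul_one _).symm
    _ ≤ Real.sqrt (((((ℓ + 1 : ℕ) : ℝ) ^ (d + 1)) ^ lvl i.hN i.D i.hk y')⁻¹) *
        (Real.exp ((δ + ε) * ((ℓ : ℝ) + 4)) * Real.exp (-((δ + ε) * (geo9K i).dist y y'))) *
          ((geo9K i).L * Real.exp (ε * (geo9K i).dist y y') * (((geo9K i).len y)⁻¹ * (geo9K i).len y')) :=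
        mul_le_mul_of_nonneg_left h1 (by positivity)
    _ = (geo9K i).L * Real.exp ((δ + ε) * ((ℓ : ℝ) + 4)) * ((geo9K i).len y)⁻¹ *
          (Real.sqrt (((((ℓ + 1 : ℕ) : ℝ) ^ (d + 1)) ^ lvl i.hN i.D i.hk y')⁻¹) * (geo9K i).len y') *
          (Real.exp (-((δ + ε) * (geo9K i).dist y y')) * Real.exp (ε * (geo9K i).dist y y')) := by ring
    _ = _ := by rw [hE]

end L2

/-! ## §3 At node00-def-Y's members: the block-L² letters at the certificate's pins -/

section Members

open scoped Matrix.Norms.L2Operator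
open B7Prop2SpecialUnitary (specialUnitaryUnits)
open B9PinMembersKLevelV1 (MemberY geo9Y bg9Y)
open B9CoReadingCoordsTranspose (TrIdx trBasis)

variable {Mstar : ℕ} {N : ℕ} [NeZero N]
variable [∀ x : MemberY d ℓ hd hL b₀ b₁ Mstar, Fintype (geo9Y x).Site]

/-- ★★ **THE BLOCK-L² LETTER `Q*(U)` AT THE CERTIFICATE'S PINS, EVERY MEMBER, EVERY REGULAR `U`**:
`‖1_{Δ(y)}Q*(U)μ‖₂ ≤ √(n_{y′}⁻¹)·e^{δ(ℓ+4)}·e^{−δd(y,y′)}·‖1_{Δ(y′)}μ‖₂`, every `δ ≥ 0`.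
[cite: Balaban1985BackgroundPropagators, (3.12)–(3.14) p.393, (3.110) p.417, (3.46) p.398, Thm 3.13 p.426; Balaban1984PropagatorsI, (1.18) p.20] -/
theorem blockBd_Qstar_pins (x : MemberY d ℓ hd hL b₀ b₁ Mstar) {bI : FBondY x.toKIdx → IBondY x.toKIdx}
    (hβ1 : ∀ f : FBondY x.toKIdx, (geomT x.D).dist (β x.hN x.D x.hk (bI f)) (blkV1 x.hN x.D f) ≤ 1) {c α₀ : ℝ}
    {U : (bg9Y (Matrix (Fin N) (Fin N) ℂ) (specialUnitaryUnits (Fin N)) x).Cfg}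
    (hU : (bg9Y (Matrix (Fin N) (Fin N) ℂ) (specialUnitaryUnits (Fin N)) x).Reg335 c α₀ U)
    {δ : ℝ} (hδ : 0 ≤ δ) (R₀ : ℝ) (H₀ : Prop) :
    BlockBd (g := toB6 (geo9Y x) R₀ H₀) (blkHK x.toKIdx) (blkBK x.toKIdx bI)
      (QscoKH x.toKIdx (trBasis N) (bg9Y (Matrix (Fin N) (Fin N) ℂ) (specialUnitaryUnits (Fin N)) x) (fun U => U) (parBY x.toKIdx) U)
      (fun y y' => Real.sqrt (((((ℓ + 1 : ℕ) : ℝ) ^ (d + 1)) ^ lvl x.hN x.D x.hk y')⁻¹) *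
        (Real.exp (δ * ((ℓ : ℝ) + 4)) * Real.exp (-(δ * (geo9Y x).dist y y')))) := by
  letI : Fintype (geo9K x.toKIdx).Site := (inferInstance : Fintype (geo9Y x).Site)
  exact blockBd_QscoKH x.toKIdx (trBasis N) (bg9Y (Matrix (Fin N) (Fin N) ℂ) (specialUnitaryUnits (Fin N)) x) (fun U => U)
    (parBY x.toKIdx) hβ1 (parBY_norm_le_one_of_reg335 x hU) hδ R₀ H₀

/-- ★ **THE BLOCK-L² LETTER AT THE PINS, LENGTH-RATIO FORM**, above the (2.60) threshold `log L ≤ ε(2L² − 1)M`: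
`‖1_{Δ(y)}Q*(U)μ‖₂ ≤ L·e^{(δ+ε)(ℓ+4)}·(Lʲη)⁻¹·(√(n_{y′}⁻¹)·L^{j′}η)·e^{−δd(y,y′)}·‖1_{Δ(y′)}μ‖₂`.
[cite: Balaban1985BackgroundPropagators, (3.46) p.398 + p.398 (remark after (3.47)), Thm 3.13 p.426; Balaban1984PropagatorsII, Lemma 2.1 (2.60) p.234] -/
theorem blockBd_Qstar_pins_len (x : MemberY d ℓ hd hL b₀ b₁ Mstar) {bI : FBondY x.toKIdx → IBondY x.toKIdx}
    (hβ1 : ∀ f : FBondY x.toKIdx, (geomT x.D).dist (β x.hN x.D x.hk (bI f)) (blkV1 x.hN x.D f) ≤ 1) {c α₀ : ℝ}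
    {U : (bg9Y (Matrix (Fin N) (Fin N) ℂ) (specialUnitaryUnits (Fin N)) x).Cfg}
    (hU : (bg9Y (Matrix (Fin N) (Fin N) ℂ) (specialUnitaryUnits (Fin N)) x).Reg335 c α₀ U)
    {δ ε : ℝ} (hδ : 0 ≤ δ) (hε : 0 < ε)
    (hM : Real.log (geo9Y x).L ≤ ε * (2 * ((ℓ : ℝ) + 1) ^ 2 - 1) * (geo9Y x).M) (R₀ : ℝ) (H₀ : Prop) :
    BlockBd (g := toB6 (geo9Y x) R₀ H₀) (blkHK x.toKIdx) (blkBK x.toKIdx bI)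
      (QscoKH x.toKIdx (trBasis N) (bg9Y (Matrix (Fin N) (Fin N) ℂ) (specialUnitaryUnits (Fin N)) x) (fun U => U) (parBY x.toKIdx) U)
      (fun y y' => (geo9Y x).L * Real.exp ((δ + ε) * ((ℓ : ℝ) + 4)) * ((geo9Y x).len y)⁻¹ *
        (Real.sqrt (((((ℓ + 1 : ℕ) : ℝ) ^ (d + 1)) ^ lvl x.hN x.D x.hk y')⁻¹) * (geo9Y x).len y') *
          Real.exp (-(δ * (geo9Y x).dist y y'))) := by
  letI : Fintype (geo9K x.toKIdx).Site := (inferInstance : Fintype (geo9Y x).Site)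
  exact blockBd_QscoKH_len x.toKIdx (trBasis N) (bg9Y (Matrix (Fin N) (Fin N) ℂ) (specialUnitaryUnits (Fin N)) x) (fun U => U)
    (parBY x.toKIdx) hβ1 (parBY_norm_le_one_of_reg335 x hU) hδ hε hM R₀ H₀

end Members

end Literature.MathematicalPhysics.QuantumFieldTheory.Balaban1983to89.B9QstarLettersAtPinsL2

end
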